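import Summits.ValiantsHypothesis.ValiantsHypothesis.Theorems.BarrierLeverChowHitsThinRowPartitionMinorsRDefectOne

/-!
# Route BarrierLever — item `ChowHitsThinRowPartitionMinorsR` (stmt-ValiantsHypothesis-21850, budget
# `h·h`): relabelling lemma for a STAR of x-dedicated pair rows

Helper file (`--supports stmt-ValiantsHypothesis-21850`; cell valiant-natproofs, rung V4, 𝒟-side;
seat val-np-p5 gen 28).  Closes NO item; definition-free; imports this seat's `…RDefectOne`.

`exists_starRelabel`: given rows `u` (injective, thin) containing a STAR of triangles — singleton rows
`{a₀}` and `{x}`, pair rows `{a₀, x}` for `x ∈ B` (row maps `σ`, `ρ`) — and a down-closed injective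
monomial basis `U` of the columns (`det [U i ⊆ w j] ≠ 0`) containing a matching star of pair labels
`{v₀, φ x}` (`x ∈ B`, `φ` injective on `B`, `φ x ≠ v₀`) and the singleton of every used coordinate
outside a set `Dx`, there is a RELABELLING `U' = U ∘ π` (same basis, rows permuted) with:
empty row ↦ `∅`, `{a₀} ↦ {v₀}`, `{x} ↦ {φ x}`, `{a₀,x} ↦ {v₀, φ x}`, and as many further singleton rows
as possible on used singleton labels, whence the cost bound
`|Sing.image U' ∪ Cu.image singleton| ≤ max |Cu| (|Sing| + |Dx|)`.
This is the combinatorial half of `chowHitsHH_of_xdedStar` (file `…RStar`): with `Xd = ρ(B)` in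
`chowHitsHH_of_labels_xded` (p695022) it yields «affine defect ≤ 2·|B| + slack ⇒ hit».

WHAT THIS IS NOT: item 21850 is NOT proved; nothing on items 21882 / 19717, on crux
stmt-ValiantsHypothesis-14610, or on `VP` versus `VNP`.
-/

set_option linter.dupNamespace false

namespace Summit.ValiantsHypothesis.ValiantsHypothesis.Theorems.BarrierLever.ChowThinHH

open Finset MvPolynomial

variable {h r : ℕ}

/-- **Star relabelling lemma** (see the module docstring). -/
theorem exists_starRelabel (u w : Fin r → Finset (Fin h)) (hu : Function.Injective u)
    (U : Fin r → Finset (Fin h)) (hUinj : Function.Injective U)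
    (hUdown : ∀ i (S : Finset (Fin h)), S ⊆ U i → ∃ i', U i' = S)
    (hZ : (Matrix.of fun i j : Fin r => if U i ⊆ w j then (1 : ℂ) else 0).det ≠ 0)
    (a₀ : Fin h) (B : Finset (Fin h)) (haB : a₀ ∉ B)
    (σ : Fin h → Fin r) (hσ : ∀ x ∈ insert a₀ B, u (σ x) = {x})
    (ρ : Fin h → Fin r) (hρ : ∀ x ∈ B, u (ρ x) = {a₀, x})
    (v₀ : Fin h) (φ : Fin h → Fin h) (hφ : Set.InjOn φ B) (hv₀ : ∀ x ∈ B, φ x ≠ v₀)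
    (hv₀U : ∃ j, U j = {v₀}) (hKU : ∀ x ∈ B, ∃ j, U j = {v₀, φ x})
    (Dx : Finset (Fin h)) (hUsing : ∀ c ∈ Finset.univ.biUnion w, c ∉ Dx → ∃ i, U i = {c}) :
    ∃ U' : Fin r → Finset (Fin h), Function.Injective U' ∧
      (∀ i (S : Finset (Fin h)), S ⊆ U' i → ∃ i', U' i' = S) ∧
      (∀ i, u i = ∅ → U' i = ∅) ∧
      (Matrix.of fun i j : Fin r => if U' i ⊆ w j then (1 : ℂ) else 0).det ≠ 0 ∧
      U' (σ a₀) = {v₀} ∧ (∀ x ∈ B, U' (σ x) = {φ x}) ∧ (∀ x ∈ B, U' (ρ x) = {v₀, φ x}) ∧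
      ((Finset.univ.filter fun i : Fin r => (u i).card = 1).image U' ∪
          (Finset.univ.biUnion w).image fun c : Fin h => ({c} : Finset (Fin h))).card ≤
        max (Finset.univ.biUnion w).card
          ((Finset.univ.filter fun i : Fin r => (u i).card = 1).card + Dx.card) := by
  classical
  set Sing : Finset (Fin r) := Finset.univ.filter fun i : Fin r => (u i).card = 1 with hSing
  set SLab : Finset (Fin r) := Finset.univ.filter fun j : Fin r => (U j).card = 1 with hSLab
  set Cu : Finset (Fin h) := Finset.univ.biUnion w with hCu
  -- labels: `j₀ ↦ {v₀}`, `labp x ↦ {v₀, φ x}`, `lab1 x ↦ {φ x}` (`x ∈ B`), `je ↦ ∅`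
  obtain ⟨j₀, hj₀⟩ := hv₀U
  set labp : Fin h → Fin r := fun x => if hx : x ∈ B then Classical.choose (hKU x hx) else j₀
    with hlabp_def
  have hlabp : ∀ x ∈ B, U (labp x) = {v₀, φ x} := by
    intro x hx
    simp only [hlabp_def, dif_pos hx]
    exact Classical.choose_spec (hKU x hx)
  have hsub1 : ∀ x ∈ B, ({φ x} : Finset (Fin h)) ⊆ U (labp x) := fun x hx => by
    rw [hlabp x hx]; exact Finset.singleton_subset_iff.mpr (by simp)
  set lab1 : Fin h → Fin r := fun x =>
    if hx : x ∈ B then Classical.choose (hUdown (labp x) {φ x} (hsub1 x hx)) else j₀ with hlab1_def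
  have hlab1 : ∀ x ∈ B, U (lab1 x) = {φ x} := by
    intro x hx
    simp only [hlab1_def, dif_pos hx]
    exact Classical.choose_spec (hUdown (labp x) {φ x} (hsub1 x hx))
  have hlab1a : lab1 a₀ = j₀ := by simp only [hlab1_def, dif_neg haB]
  -- the label set `Λ x` of the anchor singleton row `σ x`
  set Λ : Fin h → Finset (Fin h) := fun x => if x ∈ B then {φ x} else {v₀} with hΛ
  have hUlab1 : ∀ x ∈ insert a₀ B, U (lab1 x) = Λ x := by
    intro x hx
    rcases Finset.mem_insert.mp hx with rfl | hx
    · rw [hlab1a, hj₀]; simp only [hΛ, if_neg haB]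
    · rw [hlab1 x hx]; simp only [hΛ, if_pos hx]
  have hΛcard : ∀ x, (Λ x).card = 1 := fun x => by
    simp only [hΛ]; split_ifs <;> rfl
  have hΛinj : ∀ x ∈ insert a₀ B, ∀ x' ∈ insert a₀ B, Λ x = Λ x' → x = x' := by
    intro x hx x' hx' e
    simp only [hΛ] at e
    rcases Finset.mem_insert.mp hx with rfl | hxB <;> rcases Finset.mem_insert.mp hx' with rfl | hx'B
    · rfl
    · rw [if_neg haB, if_pos hx'B] at e
      exact absurd (Finset.singleton_injective e).symm (hv₀ x' hx'B)
    · rw [if_pos hxB, if_neg haB] at e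
      exact absurd (Finset.singleton_injective e) (hv₀ x hxB)
    · rw [if_pos hxB, if_pos hx'B] at e
      exact hφ hxB hx'B (Finset.singleton_injective e)
  obtain ⟨je, hje⟩ : ∃ j, U j = ∅ := hUdown j₀ ∅ (Finset.empty_subset _)
  -- a singleton label is a used singleton
  have hlab_used : ∀ i c, U i = {c} → c ∈ Cu := by
    intro i c hic
    by_contra hc
    apply hZ
    refine Matrix.det_eq_zero_of_row_eq_zero i fun j => ?_
    rw [Matrix.of_apply, if_neg]
    intro hsub
    apply hc
    rw [hCu, Finset.mem_biUnion]
    exact ⟨j, Finset.mem_univ _, hsub (by rw [hic]; exact Finset.mem_singleton_self c)⟩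
  have hSLabCu : SLab.image U ⊆ Cu.image fun c : Fin h => ({c} : Finset (Fin h)) := by
    intro S hS
    obtain ⟨j, hj, rfl⟩ := Finset.mem_image.mp hS
    obtain ⟨c, hc⟩ := Finset.card_eq_one.mp (Finset.mem_filter.mp hj).2
    exact Finset.mem_image.mpr ⟨c, hlab_used j c hc, hc.symm⟩
  have hCuSLab : (Cu \ Dx).image (fun c : Fin h => ({c} : Finset (Fin h))) ⊆ SLab.image U := by
    intro S hS
    obtain ⟨c, hc, rfl⟩ := Finset.mem_image.mp hS
    obtain ⟨j, hj⟩ := hUsing c (Finset.mem_sdiff.mp hc).1 (Finset.mem_sdiff.mp hc).2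
    exact Finset.mem_image.mpr ⟨j, Finset.mem_filter.mpr ⟨Finset.mem_univ _, by rw [hj]; rfl⟩, hj⟩
  -- anchors: rows `AnchR = σ(insert a₀ B)`, labels `AnchL = lab1(insert a₀ B)`; facts about `σ`, `ρ`
  set AnchR : Finset (Fin r) := (insert a₀ B).image σ with hAnchR
  set AnchL : Finset (Fin r) := (insert a₀ B).image lab1 with hAnchL
  have hσinj : ∀ x ∈ insert a₀ B, ∀ x' ∈ insert a₀ B, σ x = σ x' → x = x' := fun x hx x' hx' e =>
    Finset.singleton_injective ((hσ x hx).symm.trans ((congrArg u e).trans (hσ x' hx')))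
  have hlab1inj : ∀ x ∈ insert a₀ B, ∀ x' ∈ insert a₀ B, lab1 x = lab1 x' → x = x' :=
    fun x hx x' hx' e => hΛinj x hx x' hx' (by rw [← hUlab1 x hx, ← hUlab1 x' hx', e])
  have hxa : ∀ x ∈ B, x ≠ a₀ := fun x hx e => haB (e ▸ hx)
  have hρcard : ∀ x ∈ B, (u (ρ x)).card = 2 := fun x hx => by
    rw [hρ x hx, Finset.card_pair (hxa x hx).symm]
  have hρinj : ∀ x ∈ B, ∀ x' ∈ B, ρ x = ρ x' → x = x' := by
    intro x hx x' hx' e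
    have e2 : ({a₀, x} : Finset (Fin h)) = {a₀, x'} := (hρ x hx).symm.trans ((congrArg u e).trans (hρ x' hx'))
    have hx2 : x ∈ ({a₀, x'} : Finset (Fin h)) := by rw [← e2]; simp
    rcases Finset.mem_insert.mp hx2 with h1 | h1
    · exact absurd h1 (hxa x hx)
    · exact Finset.mem_singleton.mp h1
  have hσρ : ∀ x ∈ insert a₀ B, ∀ x' ∈ B, σ x ≠ ρ x' := by
    intro x hx x' hx' e
    have := congrArg (fun i => (u i).card) e
    simp only [hσ x hx, Finset.card_singleton, hρcard x' hx'] at this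
    exact absurd this (by norm_num)
  have hσcard : ∀ x ∈ insert a₀ B, (u (σ x)).card = 1 := fun x hx => by rw [hσ x hx, Finset.card_singleton]
  have hAnchR_sub : AnchR ⊆ Sing := by
    intro i hi
    obtain ⟨x, hx, rfl⟩ := Finset.mem_image.mp hi
    exact Finset.mem_filter.mpr ⟨Finset.mem_univ _, hσcard x hx⟩
  have hAnchL_sub : AnchL ⊆ SLab := by
    intro j hj
    obtain ⟨x, hx, rfl⟩ := Finset.mem_image.mp hj
    exact Finset.mem_filter.mpr ⟨Finset.mem_univ _, by rw [hUlab1 x hx, hΛcard]⟩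
  have hAnchR_card : AnchR.card = B.card + 1 := by
    rw [hAnchR, Finset.card_image_of_injOn (fun x hx x' hx' e => hσinj x hx x' hx' e),
      Finset.card_insert_of_notMem haB]
  have hAnchL_card : AnchL.card = B.card + 1 := by
    rw [hAnchL, Finset.card_image_of_injOn (fun x hx x' hx' e => hlab1inj x hx x' hx' e),
      Finset.card_insert_of_notMem haB]
  -- matching of the remaining singleton labels with the remaining singleton rows
  set SLab' : Finset (Fin r) := SLab \ AnchL with hSLab'
  set Sing' : Finset (Fin r) := Sing \ AnchR with hSing'
  obtain ⟨M, hMsub, hMcard, g, hg⟩ : ∃ M : Finset (Fin r), M ⊆ Sing' ∧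
      M.card = min Sing'.card SLab'.card ∧ ∃ g : Fin r → Fin r, Set.InjOn g M ∧ ∀ i ∈ M, g i ∈ SLab' := by
    obtain ⟨M, hMsub, hMcard⟩ := Finset.exists_subset_card_eq
      (show min Sing'.card SLab'.card ≤ Sing'.card from min_le_left _ _)
    have hle : M.card ≤ SLab'.card := by rw [hMcard]; exact min_le_right _ _
    have hc : Fintype.card M ≤ Fintype.card SLab' := by simpa using hle
    obtain ⟨ι⟩ := Function.Embedding.nonempty_of_card_le hc
    refine ⟨M, hMsub, hMcard, fun i => if hi : i ∈ M then (ι ⟨i, hi⟩ : Fin r) else i, ?_, ?_⟩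
    · intro i hi i' hi' e
      simp only [dif_pos (show i ∈ M from hi), dif_pos (show i' ∈ M from hi')] at e
      have := ι.injective (Subtype.ext e)
      exact congrArg Subtype.val this
    · intro i hi
      simp only [dif_pos hi]
      exact (ι ⟨i, hi⟩).2
  have hMfacts : ∀ i ∈ M, (u i).card = 1 ∧ i ∉ AnchR := fun i hi => by
    have hi' := hMsub hi
    rw [hSing', Finset.mem_sdiff] at hi'
    exact ⟨(Finset.mem_filter.mp hi'.1).2, hi'.2⟩
  have hgfacts : ∀ i ∈ M, (U (g i)).card = 1 ∧ g i ∉ AnchL := fun i hi => by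
    have hgi := hg.2 i hi
    rw [hSLab', Finset.mem_sdiff] at hgi
    exact ⟨(Finset.mem_filter.mp hgi.1).2, hgi.2⟩
  -- the row → label assignment on the constrained rows `C`
  set Zr : Finset (Fin r) := Finset.univ.filter fun i : Fin r => u i = ∅ with hZr
  set Xd : Finset (Fin r) := B.image ρ with hXd
  set C : Finset (Fin r) := ((Zr ∪ AnchR) ∪ Xd) ∪ M with hC
  set f : Fin r → Fin r := fun i =>
    if u i = ∅ then je else
      if h1 : ∃ x, x ∈ insert a₀ B ∧ σ x = i then lab1 (Classical.choose h1) else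
        if h2 : ∃ x, x ∈ B ∧ ρ x = i then labp (Classical.choose h2) else g i with hf
  have hfZ : ∀ i, u i = ∅ → f i = je := fun i hi => by simp only [hf, if_pos hi]
  have hfσ : ∀ x ∈ insert a₀ B, f (σ x) = lab1 x := by
    intro x hx
    have hne : u (σ x) ≠ ∅ := by rw [hσ x hx]; exact Finset.singleton_ne_empty x
    have h1 : ∃ x', x' ∈ insert a₀ B ∧ σ x' = σ x := ⟨x, hx, rfl⟩
    have hspec := Classical.choose_spec h1
    have hx' : Classical.choose h1 = x := hσinj _ hspec.1 _ hx hspec.2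
    simp only [hf, if_neg hne, dif_pos h1, hx']
  have hfρ : ∀ x ∈ B, f (ρ x) = labp x := by
    intro x hx
    have hne : u (ρ x) ≠ ∅ := fun e => by
      have := hρcard x hx; rw [e, Finset.card_empty] at this; exact absurd this (by norm_num)
    have h1 : ¬ ∃ x', x' ∈ insert a₀ B ∧ σ x' = ρ x := fun ⟨x', hx', e⟩ => hσρ x' hx' x hx e
    have h2 : ∃ x', x' ∈ B ∧ ρ x' = ρ x := ⟨x, hx, rfl⟩
    have hspec := Classical.choose_spec h2
    have hx' : Classical.choose h2 = x := hρinj _ hspec.1 _ hx hspec.2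
    simp only [hf, if_neg hne, dif_neg h1, dif_pos h2, hx']
  have hfM : ∀ i ∈ M, f i = g i := by
    intro i hi
    have hne : u i ≠ ∅ := fun e => by
      have := (hMfacts i hi).1; rw [e, Finset.card_empty] at this; exact absurd this (by norm_num)
    have h1 : ¬ ∃ x', x' ∈ insert a₀ B ∧ σ x' = i := fun ⟨x', hx', e⟩ =>
      (hMfacts i hi).2 (Finset.mem_image.mpr ⟨x', hx', e⟩)
    have h2 : ¬ ∃ x', x' ∈ B ∧ ρ x' = i := fun ⟨x', hx', e⟩ => by
      have := (hMfacts i hi).1; rw [← e, hρcard x' hx'] at this; exact absurd this (by norm_num)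
    simp only [hf, if_neg hne, dif_neg h1, dif_neg h2]
  -- the label SETS on `C` and injectivity
  have hUfσ : ∀ x ∈ insert a₀ B, U (f (σ x)) = Λ x := fun x hx => by rw [hfσ x hx, hUlab1 x hx]
  have hUfρ : ∀ x ∈ B, U (f (ρ x)) = {v₀, φ x} := fun x hx => by rw [hfρ x hx, hlabp x hx]
  have hpaircard : ∀ x ∈ B, ({v₀, φ x} : Finset (Fin h)).card = 2 := fun x hx =>
    Finset.card_pair (hv₀ x hx).symm
  have hinj : Set.InjOn f C := by
    intro i hi i' hi' e
    have eU : U (f i) = U (f i') := by rw [e]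
    simp only [hC, Finset.coe_union, Set.mem_union, Finset.mem_coe, hZr, Finset.mem_filter,
      Finset.mem_univ, true_and] at hi hi'
    -- membership cases: Zr | AnchR | Xd | M
    rcases hi with ((hi | hi) | hi) | hi <;> rcases hi' with ((hi' | hi') | hi') | hi'
    · exact hu (hi.trans hi'.symm)
    · obtain ⟨x', hx', rfl⟩ := Finset.mem_image.mp hi'
      rw [hfZ i hi, hje, hUfσ x' hx'] at eU
      exact absurd (congrArg Finset.card eU) (by rw [hΛcard, Finset.card_empty]; norm_num)
    · obtain ⟨x', hx', rfl⟩ := Finset.mem_image.mp hi'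
      rw [hfZ i hi, hje, hUfρ x' hx'] at eU
      exact absurd (congrArg Finset.card eU) (by rw [hpaircard x' hx', Finset.card_empty]; norm_num)
    · rw [hfZ i hi, hje, hfM i' hi'] at eU
      exact absurd (congrArg Finset.card eU) (by rw [(hgfacts i' hi').1, Finset.card_empty]; norm_num)
    · obtain ⟨x, hx, rfl⟩ := Finset.mem_image.mp hi
      rw [hfZ i' hi', hje, hUfσ x hx] at eU
      exact absurd (congrArg Finset.card eU) (by rw [hΛcard, Finset.card_empty]; norm_num)
    · obtain ⟨x, hx, rfl⟩ := Finset.mem_image.mp hi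
      obtain ⟨x', hx', rfl⟩ := Finset.mem_image.mp hi'
      rw [hUfσ x hx, hUfσ x' hx'] at eU
      rw [hΛinj x hx x' hx' eU]
    · obtain ⟨x, hx, rfl⟩ := Finset.mem_image.mp hi
      obtain ⟨x', hx', rfl⟩ := Finset.mem_image.mp hi'
      rw [hUfσ x hx, hUfρ x' hx'] at eU
      exact absurd (congrArg Finset.card eU) (by rw [hΛcard, hpaircard x' hx']; norm_num)
    · obtain ⟨x, hx, rfl⟩ := Finset.mem_image.mp hi
      rw [hfσ x hx, hfM i' hi'] at e
      exact absurd (Finset.mem_image.mpr ⟨x, hx, e⟩) (hgfacts i' hi').2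
    · obtain ⟨x, hx, rfl⟩ := Finset.mem_image.mp hi
      rw [hfZ i' hi', hje, hUfρ x hx] at eU
      exact absurd (congrArg Finset.card eU) (by rw [hpaircard x hx, Finset.card_empty]; norm_num)
    · obtain ⟨x, hx, rfl⟩ := Finset.mem_image.mp hi
      obtain ⟨x', hx', rfl⟩ := Finset.mem_image.mp hi'
      rw [hUfρ x hx, hUfσ x' hx'] at eU
      exact absurd (congrArg Finset.card eU) (by rw [hΛcard, hpaircard x hx]; norm_num)
    · obtain ⟨x, hx, rfl⟩ := Finset.mem_image.mp hi
      obtain ⟨x', hx', rfl⟩ := Finset.mem_image.mp hi'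
      rw [hUfρ x hx, hUfρ x' hx'] at eU
      have hm : φ x ∈ ({v₀, φ x'} : Finset (Fin h)) := by rw [← eU]; simp
      rcases Finset.mem_insert.mp hm with h1 | h1
      · exact absurd h1 (hv₀ x hx)
      · rw [hφ hx hx' (Finset.mem_singleton.mp h1)]
    · obtain ⟨x, hx, rfl⟩ := Finset.mem_image.mp hi
      rw [hUfρ x hx, hfM i' hi'] at eU
      exact absurd (congrArg Finset.card eU) (by rw [hpaircard x hx, (hgfacts i' hi').1]; norm_num)
    · rw [hfM i hi, hfZ i' hi', hje] at eU
      exact absurd (congrArg Finset.card eU) (by rw [(hgfacts i hi).1, Finset.card_empty]; norm_num)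
    · obtain ⟨x', hx', rfl⟩ := Finset.mem_image.mp hi'
      rw [hfM i hi, hfσ x' hx'] at e
      exact absurd (Finset.mem_image.mpr ⟨x', hx', e.symm⟩) (hgfacts i hi).2
    · obtain ⟨x', hx', rfl⟩ := Finset.mem_image.mp hi'
      rw [hfM i hi, hUfρ x' hx'] at eU
      exact absurd (congrArg Finset.card eU) (by rw [hpaircard x' hx', (hgfacts i hi).1]; norm_num)
    · rw [hfM i hi, hfM i' hi'] at e
      exact hg.1 hi hi' e
  obtain ⟨ge, hge⟩ := Finset.exists_equiv_extend_of_card_eq (t := (Finset.univ : Finset (Fin r)))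
    (by simp) (s := C) (f := f) (Finset.subset_univ _) hinj
  set π : Fin r ≃ Fin r := ge.trans (Equiv.subtypeUnivEquiv Finset.mem_univ) with hπ
  have hπC : ∀ i ∈ C, π i = f i := by
    intro i hi
    rw [← hge i hi]
    rfl
  have hZC : ∀ i, u i = ∅ → i ∈ C := fun i hi =>
    Finset.mem_union_left _ (Finset.mem_union_left _ (Finset.mem_union_left _
      (Finset.mem_filter.mpr ⟨Finset.mem_univ _, hi⟩)))
  have hσC : ∀ x ∈ insert a₀ B, σ x ∈ C := fun x hx =>
    Finset.mem_union_left _ (Finset.mem_union_left _ (Finset.mem_union_right _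
      (Finset.mem_image_of_mem σ hx)))
  have hρC : ∀ x ∈ B, ρ x ∈ C := fun x hx =>
    Finset.mem_union_left _ (Finset.mem_union_right _ (Finset.mem_image_of_mem ρ hx))
  have hMC : ∀ i ∈ M, i ∈ C := fun i hi => Finset.mem_union_right _ hi
  -- the relabelling
  set U' : Fin r → Finset (Fin h) := fun i => U (π i) with hU'
  have hU'inj : Function.Injective U' := hUinj.comp π.injective
  have hU'down : ∀ i (S : Finset (Fin h)), S ⊆ U' i → ∃ i', U' i' = S := by
    intro i S hS
    obtain ⟨j', hj'⟩ := hUdown (π i) S hS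
    exact ⟨π.symm j', by simp only [hU', Equiv.apply_symm_apply, hj']⟩
  have hU'empty : ∀ i, u i = ∅ → U' i = ∅ := by
    intro i hi
    show U (π i) = ∅
    rw [hπC i (hZC i hi), hfZ i hi, hje]
  have hU'σ : ∀ x ∈ insert a₀ B, U' (σ x) = Λ x := fun x hx => by
    show U (π (σ x)) = Λ x
    rw [hπC _ (hσC x hx), hUfσ x hx]
  have hU'ρ : ∀ x ∈ B, U' (ρ x) = {v₀, φ x} := fun x hx => by
    show U (π (ρ x)) = {v₀, φ x}
    rw [hπC _ (hρC x hx), hUfρ x hx]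
  have hU'M : ∀ i ∈ M, U' i ∈ Cu.image fun c : Fin h => ({c} : Finset (Fin h)) := by
    intro i hi
    apply hSLabCu
    refine Finset.mem_image.mpr ⟨π i, ?_, rfl⟩
    rw [hπC i (hMC i hi), hfM i hi]
    exact Finset.mem_filter.mpr ⟨Finset.mem_univ _, (hgfacts i hi).1⟩
  have hU'A : ∀ i ∈ AnchR, U' i ∈ Cu.image fun c : Fin h => ({c} : Finset (Fin h)) := by
    intro i hi
    obtain ⟨x, hx, rfl⟩ := Finset.mem_image.mp hi
    apply hSLabCu
    refine Finset.mem_image.mpr ⟨π (σ x), ?_, rfl⟩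
    rw [hπC _ (hσC x hx), hfσ x hx]
    exact hAnchL_sub (Finset.mem_image_of_mem lab1 hx)
  have hZ' : (Matrix.of fun i j : Fin r => if U' i ⊆ w j then (1 : ℂ) else 0).det ≠ 0 := by
    have e : (Matrix.of fun i j : Fin r => if U' i ⊆ w j then (1 : ℂ) else 0) =
        (Matrix.of fun i j : Fin r => if U i ⊆ w j then (1 : ℂ) else 0).submatrix π id := by
      ext i j
      rfl
    rw [e, Matrix.det_permute]
    refine mul_ne_zero ?_ hZ
    rcases Int.units_eq_one_or (Equiv.Perm.sign π) with h1 | h1 <;> simp [h1]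
  refine ⟨U', hU'inj, hU'down, hU'empty, hZ', ?_, fun x hx => ?_, hU'ρ, ?_⟩
  · rw [hU'σ a₀ (Finset.mem_insert_self _ _)]; simp only [hΛ, if_neg haB]
  · rw [hU'σ x (Finset.mem_insert_of_mem hx)]; simp only [hΛ, if_pos hx]
  -- the cost bound
  have hsub : Sing.image U' ∪ Cu.image (fun c : Fin h => ({c} : Finset (Fin h))) ⊆
      (Sing \ (AnchR ∪ M)).image U' ∪ Cu.image (fun c : Fin h => ({c} : Finset (Fin h))) := by
    intro S hS
    rcases Finset.mem_union.mp hS with h1 | h2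
    · obtain ⟨i, hi, rfl⟩ := Finset.mem_image.mp h1
      by_cases hiA : i ∈ AnchR
      · exact Finset.mem_union_right _ (hU'A i hiA)
      by_cases hiM : i ∈ M
      · exact Finset.mem_union_right _ (hU'M i hiM)
      · exact Finset.mem_union_left _ (Finset.mem_image.mpr
          ⟨i, Finset.mem_sdiff.mpr ⟨hi, by rw [Finset.mem_union, not_or]; exact ⟨hiA, hiM⟩⟩, rfl⟩)
    · exact Finset.mem_union_right _ h2
  have hAMsub : AnchR ∪ M ⊆ Sing := Finset.union_subset hAnchR_sub
    (fun i hi => (Finset.mem_sdiff.mp (hMsub hi)).1)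
  have hAMdisj : Disjoint AnchR M := Finset.disjoint_right.mpr fun i hi => (hMfacts i hi).2
  have hAMcard : (AnchR ∪ M).card = B.card + 1 + M.card := by
    rw [Finset.card_union_of_disjoint hAMdisj, hAnchR_card]
  have hSing'card : Sing'.card = Sing.card - (B.card + 1) := by
    rw [hSing', Finset.card_sdiff_of_subset hAnchR_sub, hAnchR_card]
  have hSLab'card : SLab'.card = SLab.card - (B.card + 1) := by
    rw [hSLab', Finset.card_sdiff_of_subset hAnchL_sub, hAnchL_card]
  have hAle : B.card + 1 ≤ Sing.card := by
    rw [← hAnchR_card]; exact Finset.card_le_card hAnchR_sub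
  have hLle : B.card + 1 ≤ SLab.card := by
    rw [← hAnchL_card]; exact Finset.card_le_card hAnchL_sub
  have hCu_le : Cu.card ≤ SLab.card + Dx.card := by
    have h1 : ((Cu \ Dx).image fun c : Fin h => ({c} : Finset (Fin h))).card ≤ (SLab.image U).card :=
      Finset.card_le_card hCuSLab
    rw [Finset.card_image_of_injective _ (Finset.singleton_injective),
      Finset.card_image_of_injective _ hUinj] at h1
    have h3 : Cu.card ≤ (Cu \ Dx).card + Dx.card := Finset.card_le_card_sdiff_add_card
    omega
  have hbound : (Sing.image U' ∪ Cu.image (fun c : Fin h => ({c} : Finset (Fin h)))).card ≤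
      (Sing.card - (B.card + 1 + M.card)) + Cu.card := by
    refine (Finset.card_le_card hsub).trans ((Finset.card_union_le _ _).trans ?_)
    refine Nat.add_le_add (Finset.card_image_le.trans ?_) Finset.card_image_le
    rw [Finset.card_sdiff_of_subset hAMsub, hAMcard]
  refine hbound.trans ?_
  rw [hMcard, hSing'card, hSLab'card]
  rcases le_total (Sing.card - (B.card + 1)) (SLab.card - (B.card + 1)) with hle | hle
  · rw [min_eq_left hle]
    refine le_trans ?_ (le_max_left _ _)
    omega
  · rw [min_eq_right hle]
    refine le_trans ?_ (le_max_right _ _)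
    omega

end Summit.ValiantsHypothesis.ValiantsHypothesis.Theorems.BarrierLever.ChowThinHH
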